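import Summits.Ventures.Crystal3D.Theorems.StickyWulffConstantTextureBuildExposedFar
import HarnessLib

/-!
# TB-energy blueprint, the CONTACT engine: what touches a piece across a facet (the flipped cell), the cut side, the classification scheme
# (lane T, crux `TextureLiminfV5`, stmt-Ventures-23912; TB-D-3-g20 §LP2 + addendum «CONTACT ENGINE»; serves stub_LP2 / stub_LS)

HONEST FRAMING. Venture `Summits/Ventures/Crystal3D` (cell `crystal3d-full`), route `route-Ventures-StickyWulffConstant`, helper `--supports` the
law-v5 crux `TextureLiminfV5` (stmt-Ventures-23912).  Bookkeeping over the labelled cells of a texture input (standard axioms; no mesh constructed; F-C1 not moved).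

WHAT.  The contact classification (L-P2) of the blueprint asks, for two pieces `i, i'` of different classes and a facet datum `p` of `i`, that the
contact `closure i ∩ {⟪p.1,·⟫ = p.2} ∩ closure i'` be special, free, or a.e. designated.  This file supplies the engine every row uses:
* `signs_of_contact` — at a GENERIC contact point the other piece IS the flipped cell (an open set cannot hide in a plane); hence `antip p ∈ Hp i'`
  (`antip_mem_Hp_of_contact`), containers off the contact plane are shared (`subset_iff_of_contact`), and a container one piece leaves has `p`
  (resp. `antip p`) among its constraints (`mem_of_contact_of_subset`, `antip_mem_of_contact_of_subset`);
* the cut side (`cutDatum_mem_T_of_height_lt`, `cutDatum_not_mem_T_of_lt_height`), genericity versus arrangement data (`eq_or_eq_antip_of_generic`);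
* the SCHEME `classify_of_point`: to prove «P ∨ (contact ∖ designated is null)» it suffices to derive `P` from ONE generic contact point outside the
  designated regions `Mesh₅.desOf₂ p` (the filter of `wall_le_split`).
-/

noncomputable section

open scoped BigOperators InnerProductSpace ENNReal
open MeasureTheory Set

namespace Summit.Ventures.Crystal3D.Cruxes.TextureLiminf.TexShadow

open Summit.Ventures.Crystal3D Summit.Ventures.Crystal3D.Theorems

/-! ### Signed data -/

/-- Membership in a signed constraint set. -/
theorem mem_signedH_iff {𝓗 T : Finset (E3 × ℝ)} {q : E3 × ℝ} :
    q ∈ signedH 𝓗 T ↔ ∃ p ∈ 𝓗, (p ∈ T ∧ p = q) ∨ (p ∉ T ∧ antip p = q) := by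
  classical
  unfold signedH
  rw [Finset.mem_image]
  refine exists_congr fun p => and_congr_right fun _ => ?_
  by_cases hpT : p ∈ T
  · simp [hpT]
  · simp only [hpT, if_false, not_false_eq_true, true_and, false_and, false_or]
    exact Iff.rfl

/-- Across a facet: if `T'` has the signs of `flipT 𝓗 T q` and `q ∈ signedH 𝓗 T`, then `antip q ∈ signedH 𝓗 T'`. -/
theorem antip_mem_signedH_of_flip {𝓗 T T' : Finset (E3 × ℝ)} {q : E3 × ℝ} (hq : q ∈ signedH 𝓗 T)
    (hT' : ∀ p ∈ 𝓗, (p ∈ T' ↔ p ∈ flipT 𝓗 T q)) : antip q ∈ signedH 𝓗 T' := by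
  obtain ⟨p, hp, h⟩ := exists_mem_of_mem_signedH hq
  rw [mem_signedH_iff]
  refine ⟨p, hp, ?_⟩
  rcases h with ⟨hpT, rfl⟩ | ⟨hpT, hpq⟩
  · have : p ∉ T' := fun h' => ((mem_flipT_of_eq hp (Or.inl rfl)).1 ((hT' p hp).1 h')) hpT
    exact Or.inr ⟨this, rfl⟩
  · have hmem : p ∈ T' := (hT' p hp).2 ((mem_flipT_of_eq hp (Or.inr hpq)).2 hpT)
    exact Or.inl ⟨hmem, hpq⟩

/-- An open nonempty set is not contained in a plane. -/
theorem not_subset_plane_of_isOpen {W : Set E3} (hW : IsOpen W) (hne : W.Nonempty) {ν : E3} (hν : ν ≠ 0) (c : ℝ) :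
    ¬ W ⊆ {x : E3 | ⟪ν, x⟫_ℝ = c} := by
  intro h
  have hpos : 0 < volume W := hW.measure_pos volume hne
  have h0 : volume W = 0 := measure_mono_null h (volume_setOf_inner_eq_zero hν c)
  rw [h0] at hpos
  exact lt_irrefl _ hpos

namespace Mesh₅

variable {C R₀ : ℝ} {N : ℕ} {x : Fin N → E3} {rc : RiseredCover C R₀ N x} {δ : ℝ} (μ : Mesh₅ rc δ)

/-- the designated regions usable by a CONTACT along the datum `p` (either orientation; the filter of `wall_le_split`) -/
def desOf₂ (p : E3 × ℝ) : Set E3 :=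
  ⋃ d ∈ μ.desSet.filter (fun d => (d.2.1, d.2.2) = p ∨ (-d.2.1, -d.2.2) = p), facetOf d.1 d.2

/-- A designated facet with datum `p` or `antip p` is usable by a contact along `p`. -/
theorem mem_desOf₂ {d : Finset (E3 × ℝ) × (E3 × ℝ)} (hd : d ∈ μ.desSet) {p : E3 × ℝ} (hq : d.2 = p ∨ d.2 = antip p) {y : E3}
    (hy : y ∈ facetOf d.1 d.2) : y ∈ μ.desOf₂ p := by
  simp only [desOf₂, mem_iUnion, Finset.mem_filter, exists_prop]
  refine ⟨d, ⟨hd, ?_⟩, hy⟩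
  rcases hq with h | h
  · left; rw [← h]
  · right; show antip d.2 = p; rw [h, antip_antip]

end Mesh₅

namespace TexInput

variable {C R₀ : ℝ} {N : ℕ} {x : Fin N → E3} {rc : RiseredCover C R₀ N x} {δ : ℝ} {μ : Mesh₅ rc δ} (I : TexInput rc μ)

/-! ### The contact set and the flipped cell -/

/-- the CONTACT of pieces `i`, `i'` along the facet datum `p` of `i` -/
def contact (i i' : Fin I.cells.M) (p : E3 × ℝ) : Set E3 :=
  closure (polytope (I.cells.Hp i)) ∩ {y : E3 | ⟪p.1, y⟫_ℝ = p.2} ∩ closure (polytope (I.cells.Hp i'))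

/-- Pieces with different classes are different. -/
theorem ne_of_cls_ne {i i' : Fin I.cells.M} (h : I.cells.cls i' ≠ I.cells.cls i) : i ≠ i' := fun e => h (by rw [e])

/-- Facet normals of pieces are nonzero. -/
theorem fst_ne_zero_of_mem_Hp {i : Fin I.cells.M} {p : E3 × ℝ} (hp : p ∈ I.cells.Hp i) : p.1 ≠ 0 := by
  intro h
  have := I.cells.hunit_Hp i p hp
  rw [h, norm_zero] at this
  exact zero_ne_one this

/-- **At a generic contact point the other piece IS the flipped cell** (its positive part has the flipped signs). -/
theorem signs_of_contact {i i' : Fin I.cells.M} (hne : i ≠ i') {p : E3 × ℝ} (hp : p ∈ I.cells.Hp i) {y : E3}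
    (hy : y ∈ I.contact i i' p) (hgen : I.Generic p y) :
    ∀ p₀ ∈ I.𝓗, (p₀ ∈ I.cells.T (I.cells.idx i') ↔ p₀ ∈ flipT I.𝓗 (I.cells.T (I.cells.idx i)) p) := by
  classical
  obtain ⟨⟨hyi, -⟩, hyi'⟩ := hy
  obtain ⟨ε, hε, hfar, hnear⟩ := ball_subset_flip_and_self (𝓗 := I.𝓗) (T := I.cells.T (I.cells.idx i)) hp hyi hgen
  by_contra hcon
  have hdisj' : Disjoint (I.cells.cell (I.cells.idx i')) (polytope (signedH I.𝓗 (flipT I.𝓗 (I.cells.T (I.cells.idx i)) p))) := by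
    by_contra hnd
    exact hcon (signs_agree_of_not_disjoint hnd)
  have hdisj : Disjoint (I.cells.cell (I.cells.idx i')) (I.cells.cell (I.cells.idx i)) :=
    I.cells.disjoint_cell fun h => hne (I.cells.idx_injective h).symm
  -- the open set `cell i' ∩ ball y ε` would lie in the plane of `p`
  have hW : I.cells.cell (I.cells.idx i') ∩ Metric.ball y ε ⊆ {x : E3 | ⟪p.1, x⟫_ℝ = p.2} := by
    rintro z ⟨hzi', hzb⟩
    rcases lt_trichotomy (⟪p.1, z⟫_ℝ) p.2 with hlt | heq | hgt
    · exact absurd (hnear ⟨hzb, hlt⟩) (Set.disjoint_left.1 hdisj hzi')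
    · exact heq
    · exact absurd (hfar ⟨hzb, hgt⟩) (Set.disjoint_left.1 hdisj' hzi')
  have hWne : (I.cells.cell (I.cells.idx i') ∩ Metric.ball y ε).Nonempty := by
    obtain ⟨z, hz, hzd⟩ := Metric.mem_closure_iff.1 hyi' ε hε
    exact ⟨z, hz, Metric.mem_ball'.2 hzd⟩
  exact not_subset_plane_of_isOpen ((I.isOpen_cell _).inter Metric.isOpen_ball) hWne (I.fst_ne_zero_of_mem_Hp hp) p.2 hW

/-- The other piece is the flipped cell, as a set. -/
theorem polytope_eq_flip_of_contact {i i' : Fin I.cells.M} (hne : i ≠ i') {p : E3 × ℝ} (hp : p ∈ I.cells.Hp i) {y : E3}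
    (hy : y ∈ I.contact i i' p) (hgen : I.Generic p y) :
    polytope (I.cells.Hp i') = polytope (signedH I.𝓗 (flipT I.𝓗 (I.cells.T (I.cells.idx i)) p)) := by
  show polytope (signedH I.𝓗 _) = _
  rw [signedH_eq_of_signs_agree (I.signs_of_contact hne hp hy hgen)]

/-- **`antip p` is a facet datum of the other piece.** -/
theorem antip_mem_Hp_of_contact {i i' : Fin I.cells.M} (hne : i ≠ i') {p : E3 × ℝ} (hp : p ∈ I.cells.Hp i) {y : E3}
    (hy : y ∈ I.contact i i' p) (hgen : I.Generic p y) : antip p ∈ I.cells.Hp i' :=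
  antip_mem_signedH_of_flip hp (I.signs_of_contact hne hp hy hgen)

/-- The contact relation is symmetric (along `antip p`). -/
theorem contact_symm {i i' : Fin I.cells.M} {p : E3 × ℝ} {y : E3} (hy : y ∈ I.contact i i' p) : y ∈ I.contact i' i (antip p) := by
  obtain ⟨⟨hyi, hyq⟩, hyi'⟩ := hy
  refine ⟨⟨hyi', ?_⟩, hyi⟩
  simp only [antip, mem_setOf_eq, inner_neg_left]
  rw [hyq]

/-- Genericity is symmetric in the orientation of the datum. -/
theorem generic_antip {p : E3 × ℝ} {y : E3} (hgen : I.Generic p y) : I.Generic (antip p) y := by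
  intro p₀ hp₀ hne
  refine hgen p₀ hp₀ fun h => hne ?_
  rcases h with h | h
  · exact Or.inr (by rw [h, antip_antip])
  · exact Or.inl h

/-- **Containers off the contact plane are shared** (`G ⊆ 𝓗` with no constraint on the plane of `p`). -/
theorem subset_iff_of_contact {i i' : Fin I.cells.M} (hne : i ≠ i') {p : E3 × ℝ} (hp : p ∈ I.cells.Hp i) {y : E3}
    (hy : y ∈ I.contact i i' p) (hgen : I.Generic p y) {G : Finset (E3 × ℝ)} (hG : G ⊆ I.𝓗)
    (hGp : ∀ p₀ ∈ G, ¬ (p₀ = p ∨ p₀ = antip p)) :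
    polytope (I.cells.Hp i) ⊆ polytope G ↔ polytope (I.cells.Hp i') ⊆ polytope G := by
  have hs := I.signs_of_contact hne hp hy hgen
  constructor
  · intro h
    have hT : G ⊆ I.cells.T (I.cells.idx i) := subset_T_of_cell_subset hG (I.cells.hne _) h
    exact cell_subset_of_subset_T hG fun p₀ hp₀ => (hs p₀ (hG hp₀)).2 ((mem_flipT_of_ne (hG hp₀) (hGp p₀ hp₀)).2 (hT hp₀))
  · intro h
    have hT : G ⊆ I.cells.T (I.cells.idx i') := subset_T_of_cell_subset hG (I.cells.hne _) h
    exact cell_subset_of_subset_T hG fun p₀ hp₀ => (mem_flipT_of_ne (hG hp₀) (hGp p₀ hp₀)).1 ((hs p₀ (hG hp₀)).1 (hT hp₀))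

/-- **A container piece `i` has and the other piece leaves carries the datum `p`.** -/
theorem mem_of_contact_of_subset {i i' : Fin I.cells.M} (hne : i ≠ i') {p : E3 × ℝ} (hp : p ∈ I.cells.Hp i) {y : E3}
    (hy : y ∈ I.contact i i' p) (hgen : I.Generic p y) {G : Finset (E3 × ℝ)} (hG : G ⊆ I.𝓗)
    (hi : polytope (I.cells.Hp i) ⊆ polytope G) (hi' : ¬ polytope (I.cells.Hp i') ⊆ polytope G) : p ∈ G := by
  have hs := I.signs_of_contact hne hp hy hgen
  have hT : G ⊆ I.cells.T (I.cells.idx i) := subset_T_of_cell_subset hG (I.cells.hne _) hi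
  by_contra hpG
  apply hi'
  refine cell_subset_of_subset_T hG fun p₀ hp₀ => ?_
  have hp₀T := hT hp₀
  by_cases hpl : p₀ = p ∨ p₀ = antip p
  · rcases hpl with rfl | hpa
    · exact absurd hp₀ hpG
    · exact absurd hp₀T (not_mem_T_of_eq_antip hp (I.cells.hne _) (hG hp₀) hpa)
  · exact (hs p₀ (hG hp₀)).2 ((mem_flipT_of_ne (hG hp₀) hpl).2 hp₀T)

/-- **A container the other piece has and `i` leaves carries the datum `antip p`.** -/
theorem antip_mem_of_contact_of_subset {i i' : Fin I.cells.M} (hne : i ≠ i') {p : E3 × ℝ} (hp : p ∈ I.cells.Hp i) {y : E3}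
    (hy : y ∈ I.contact i i' p) (hgen : I.Generic p y) {G : Finset (E3 × ℝ)} (hG : G ⊆ I.𝓗)
    (hi' : polytope (I.cells.Hp i') ⊆ polytope G) (hi : ¬ polytope (I.cells.Hp i) ⊆ polytope G) : antip p ∈ G := by
  have hs := I.signs_of_contact hne hp hy hgen
  have hT' : G ⊆ I.cells.T (I.cells.idx i') := subset_T_of_cell_subset hG (I.cells.hne _) hi'
  by_contra hpG
  apply hi
  refine cell_subset_of_subset_T hG fun p₀ hp₀ => ?_
  have hp₀T' := hT' hp₀
  by_cases hpl : p₀ = p ∨ p₀ = antip p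
  · rcases hpl with rfl | hpa
    · exact mem_T_of_eq hp (I.cells.hne _) (hG hp₀) rfl
    · rw [hpa] at hp₀; exact absurd hp₀ hpG
  · exact (mem_flipT_of_ne (hG hp₀) hpl).1 ((hs p₀ (hG hp₀)).1 hp₀T')

/-- A contact point of a piece inside `polytope G` lies on the facet of `G` carried by `p`. -/
theorem mem_facetOf_of_contact {i i' : Fin I.cells.M} {p : E3 × ℝ} {y : E3} (hy : y ∈ I.contact i i' p) {G : Finset (E3 × ℝ)}
    (hi : polytope (I.cells.Hp i) ⊆ polytope G) : y ∈ facetOf G p :=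
  ⟨closure_mono hi hy.1.1, hy.1.2⟩

/-- The same for the other piece and `antip p`. -/
theorem mem_facetOf_antip_of_contact {i i' : Fin I.cells.M} {p : E3 × ℝ} {y : E3} (hy : y ∈ I.contact i i' p) {G : Finset (E3 × ℝ)}
    (hi' : polytope (I.cells.Hp i') ⊆ polytope G) : y ∈ facetOf G (antip p) :=
  I.mem_facetOf_of_contact (I.contact_symm hy) hi'

/-- Near a contact point there are points of the other piece. -/
theorem exists_mem_near_of_contact {i i' : Fin I.cells.M} {p : E3 × ℝ} {y : E3} (hy : y ∈ I.contact i i' p) {r : ℝ} (hr : 0 < r) :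
    ∃ z ∈ polytope (I.cells.Hp i'), dist z y < r := by
  obtain ⟨z, hz, hzd⟩ := Metric.mem_closure_iff.1 hy.2 r hr
  exact ⟨z, hz, by rw [dist_comm]; exact hzd⟩

/-! ### Dichotomy consequences: a piece touching a closed container lies inside it -/

/-- A piece containing a point of the closure of `polytope G` (`G ⊆ 𝓗`) lies inside `polytope G`. -/
theorem subset_of_mem_closure {i : Fin I.cells.M} {G : Finset (E3 × ℝ)} (hG : G ⊆ I.𝓗) {z : E3} (hz : z ∈ polytope (I.cells.Hp i))
    (hzG : z ∈ closure (polytope G)) : polytope (I.cells.Hp i) ⊆ polytope G := by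
  rcases refineCells_dichotomy I.𝓗 I.𝓗_unit I.𝒢 I.𝒢_subset_𝓗 I.𝒢_bounded I.n I.lab₀ (I.cells.idx i) G hG with h | h
  · exact h
  · exact absurd hzG (Set.disjoint_left.1 (h.closure_right (I.isOpen_cell _)) hz)

/-- A piece containing a point of the closure of a territory lies inside one of its polytopes. -/
theorem exists_subset_HD_of_mem_closure {i : Fin I.cells.M} {g : Fin rc.ng} {z : E3} (hz : z ∈ polytope (I.cells.Hp i))
    (hzD : z ∈ closure (⋃ j, polytope (μ.HD g j))) : ∃ jd, polytope (I.cells.Hp i) ⊆ polytope (μ.HD g jd) := by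
  rw [closure_iUnion_of_finite, mem_iUnion] at hzD
  obtain ⟨jd, hjd⟩ := hzD
  exact ⟨jd, I.subset_of_mem_closure (I.HD_subset_𝓗 g jd) hz hjd⟩

/-- A piece disjoint from `polytope G` misses its closure. -/
theorem disjoint_closure_of_not_subset {i : Fin I.cells.M} {G : Finset (E3 × ℝ)} (hG : G ⊆ I.𝓗)
    (h : ¬ polytope (I.cells.Hp i) ⊆ polytope G) : Disjoint (polytope (I.cells.Hp i)) (closure (polytope G)) :=
  Set.disjoint_left.2 fun _ hz hzG => h (I.subset_of_mem_closure hG hz hzG)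

/-! ### The cut side -/

/-- The cut datum of cell `k` is an arrangement datum. -/
theorem cutDatum_mem_𝓗 (k : Fin rc.nk) : I.cutDatum k ∈ I.𝓗 := by
  simp only [𝓗, Finset.mem_union, Finset.mem_biUnion, Finset.mem_univ, true_and, Finset.mem_insert, Finset.mem_singleton]
  exact Or.inl (Or.inl (Or.inl (Or.inl (Or.inl (Or.inr ⟨k, Or.inr (Or.inl rfl)⟩)))))

/-- A cell point below the cut of cell `k` puts the cut datum into the positive part. -/
theorem cutDatum_mem_T_of_height_lt {j : Fin I.cells.k} {z : E3} (hz : z ∈ I.cells.cell j) {k : Fin rc.nk} (h : rc.height k z < I.τ k) :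
    I.cutDatum k ∈ I.cells.T j := by
  by_contra hT
  have h1 := ((mem_polytope_signedH_iff I.𝓗 (I.cells.T j) z).1 hz (I.cutDatum k) (I.cutDatum_mem_𝓗 k)).2 hT
  exact lt_asymm h1 ((I.height_lt_iff k z).1 h)

/-- A cell point above the cut of cell `k` keeps the cut datum out of the positive part. -/
theorem cutDatum_not_mem_T_of_lt_height {j : Fin I.cells.k} {z : E3} (hz : z ∈ I.cells.cell j) {k : Fin rc.nk} (h : I.τ k < rc.height k z) :
    I.cutDatum k ∉ I.cells.T j := by
  intro hT
  have h1 := ((mem_polytope_signedH_iff I.𝓗 (I.cells.T j) z).1 hz (I.cutDatum k) (I.cutDatum_mem_𝓗 k)).1 hT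
  have h2 : rc.height k z < I.τ k := (I.height_lt_iff k z).2 h1
  exact lt_asymm h h2

/-- The model height of a cell is continuous. -/
theorem continuous_height (k : Fin rc.nk) : Continuous (rc.height k) := by
  unfold CellCover.height
  exact (EuclideanSpace.proj (2 : Fin 3)).continuous.comp ((rc.cell k).M.symm.continuous.comp (continuous_id.sub continuous_const))

/-- Near a point of height `< τ` the other piece has a point below the cut (and then its positive part contains the cut datum). -/
theorem cutDatum_mem_T_of_contact_lt {i i' : Fin I.cells.M} {p : E3 × ℝ} {y : E3} (hy : y ∈ I.contact i i' p) {k : Fin rc.nk}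
    (h : rc.height k y < I.τ k) : I.cutDatum k ∈ I.cells.T (I.cells.idx i') := by
  have hopen : IsOpen {z : E3 | rc.height k z < I.τ k} := isOpen_lt (continuous_height k) continuous_const
  obtain ⟨r, hr, hball⟩ := Metric.isOpen_iff.1 hopen y h
  obtain ⟨z, hz, hzd⟩ := I.exists_mem_near_of_contact hy hr
  exact I.cutDatum_mem_T_of_height_lt hz (hball (Metric.mem_ball.2 hzd))

/-- Near a point of height `> τ` the other piece has a point above the cut. -/
theorem cutDatum_not_mem_T_of_contact_gt {i i' : Fin I.cells.M} {p : E3 × ℝ} {y : E3} (hy : y ∈ I.contact i i' p) {k : Fin rc.nk}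
    (h : I.τ k < rc.height k y) : I.cutDatum k ∉ I.cells.T (I.cells.idx i') := by
  have hopen : IsOpen {z : E3 | I.τ k < rc.height k z} := isOpen_lt continuous_const (continuous_height k)
  obtain ⟨r, hr, hball⟩ := Metric.isOpen_iff.1 hopen y h
  obtain ⟨z, hz, hzd⟩ := I.exists_mem_near_of_contact hy hr
  exact I.cutDatum_not_mem_T_of_lt_height hz (hball (Metric.mem_ball.2 hzd))

/-! ### Genericity versus arrangement data -/

/-- At a generic point of the facet `p`, an arrangement datum whose plane passes through the point is `p` or `antip p`. -/
theorem eq_or_eq_antip_of_generic {p : E3 × ℝ} {y : E3} (hgen : I.Generic p y) {p₀ : E3 × ℝ} (hp₀ : p₀ ∈ I.𝓗)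
    (hy : ⟪p₀.1, y⟫_ℝ = p₀.2) : p = p₀ ∨ p = antip p₀ := by
  by_contra h
  push Not at h
  refine hgen p₀ hp₀ (fun h' => ?_) hy
  rcases h' with e | e
  · exact h.1 e.symm
  · exact h.2 (by rw [e, antip_antip])

/-- Hence its normal is `± p.1`. -/
theorem fst_eq_or_of_generic {p : E3 × ℝ} {y : E3} (hgen : I.Generic p y) {p₀ : E3 × ℝ} (hp₀ : p₀ ∈ I.𝓗)
    (hy : ⟪p₀.1, y⟫_ℝ = p₀.2) : p.1 = p₀.1 ∨ p.1 = -p₀.1 := by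
  rcases I.eq_or_eq_antip_of_generic hgen hp₀ hy with rfl | rfl
  · exact Or.inl rfl
  · exact Or.inr rfl

/-! ### The scheme -/

/-- **The contact-classification scheme, null half**: if every GENERIC contact point lies in the designated regions, the contact minus the
designated regions is null. -/
theorem facetArea_contact_diff_eq_zero {i i' : Fin I.cells.M} {p : E3 × ℝ} (hp : p ∈ I.cells.Hp i)
    (h : ∀ y ∈ I.contact i i' p, I.Generic p y → y ∈ μ.desOf₂ p) :
    facetArea (I.contact i i' p \ μ.desOf₂ p) p.1 = 0 := by
  refine le_antisymm ?_ (facetArea_nonneg _ _)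
  rw [← I.facetArea_nonGeneric_eq_zero' i hp]
  refine facetArea_mono_of_subset (I.cells.hbd_Hp i) (fun z hz => hz.1) (fun z hz => ?_) p.1
  exact ⟨hz.1.1.1, hz.1.1.2, fun hgen => hz.2 (h z hz.1 hgen)⟩

/-- **THE SCHEME**: to prove «`P` ∨ the contact along `p` minus the designated regions is null» it suffices to derive `P` from ONE generic contact
point outside the designated regions. -/
theorem classify_of_point {i i' : Fin I.cells.M} {p : E3 × ℝ} (hp : p ∈ I.cells.Hp i) {P : Prop}
    (h : ∀ y ∈ I.contact i i' p, I.Generic p y → y ∉ μ.desOf₂ p → P) :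
    P ∨ facetArea (I.contact i i' p \ μ.desOf₂ p) p.1 = 0 := by
  by_cases hex : ∃ y ∈ I.contact i i' p, I.Generic p y ∧ y ∉ μ.desOf₂ p
  · obtain ⟨y, hy, hg, hd⟩ := hex
    exact Or.inl (h y hy hg hd)
  · push Not at hex
    exact Or.inr (I.facetArea_contact_diff_eq_zero hp fun y hy hg => hex y hy hg)

end TexInput

end Summit.Ventures.Crystal3D.Cruxes.TextureLiminf.TexShadow

end
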